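/-
Copyright: derived here (Resolution Observatory cell `pub-rosobs`, carver gen 58). AI-written Lean; AI review is weaker than expert
review.  The `p`-ADIC PIN LEMMA (engine 1, THEOREM-LT-eng1-g38 §12, COROLLARY B⁗′(a)) of the cell's polynomial weighted-centre model `W(f)`:
weight combinatorics only.  Instrument — NOT a resolution theorem and NOT a statement about the invariant of [AbramovichTemkinWlodarczyk2024].
-/
import Mathlib.Data.Rat.Lemmas
import Mathlib.Data.Nat.Prime.Basic
import Mathlib.Data.Finsupp.Basic
import Mathlib.Algebra.BigOperators.Group.Finset.Basic
import Mathlib.Algebra.Order.BigOperators.Group.Finset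
import Mathlib.Algebra.Order.Field.Basic
import Mathlib.Tactic.Linarith
import Mathlib.Tactic.Ring
import Mathlib.Tactic.Push
import Mathlib.Tactic.FieldSimp
import Literature.NumberTheory.Automorphic.QuaternionIdealLocallyPrincipal
import HarnessLib

/-!
# The `p`-adic pin lemma and decoupling (COROLLARY B⁗′(a),(b) of THEOREM-LT-eng1-g38 §12)

Uniform value line: INSTRUMENT — weight combinatorics for engine 1's classification of sharp-rate systems in the cell's polynomial
weighted-centre model `W(f)`; NOT a resolution theorem, NOT a statement about the Abramovich–Temkin–Włodarczyk invariant, NOT summit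
progress; AI-written Lean, AI review is weaker than expert review.

## Dictionary (THEOREM-LT §12 ↔ this file)

* Slots `N` with weights `w : N → ℚ_{>0}`; a monomial is an exponent vector `μ : N →₀ ℕ` of VALUE `Σ_s μ_s · w_s`.
* The engine's hypothesis "[uses only the existence of pins, no isotropy] `(N, w, g)` satisfies `(P)` with threshold `η < 1/p`" enters
  only through its consequence used in the proof: every slot `ε` of weight `> 1/p` has a PIN — a value-`1` monomial `μ` with `μ_ε ≥ 1`
  all of whose variables weigh at least `w_ε` ("a value-1 monomial (class-`u₀` variables)^α · (heavier variables)^β with `|α| ≥ 1`").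
  This is the hypothesis `pin` of `pIntegral_of_pins`; deriving it from the cell's `(P)` is the reader's one-line unfolding of `(P)`.
* `p`-integrality of `q ∈ ℚ` is written `¬ p ∣ q.den`, the tree's convention (`Literature.NumberTheory.Automorphic.not_dvd_den_add`
  / `_neg` / `_sub` / `_mul` / `_intCast`, reused here) — the engine's "`p ∤` denominator of `u` in lowest terms".
* `pIntegral_of_pins` = COROLLARY B⁗′(a): every slot of weight `u > 1/p` has `p`-integral weight.  Proof = the engine's: a slot `ε₀` of
  MAXIMAL non-`p`-integral weight `u₀ > 1/p`, its pin `μ`, the split of `supp μ` into the class `w = u₀` (total exponent `|α| ≥ 1`) and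
  heavier slots (whose weights are `p`-integral by maximality), `|α|·u₀ = 1 − (p-integral)` is `p`-integral, hence `p ∣ |α|`
  (`dvd_of_not_dvd_den_mul`), so `|α|·u₀ ≥ p·u₀ > 1 ≥ |α|·u₀`.
* `dvd_fDegree`, `pure_of_mem_fClass`, `pure_of_pins` = COROLLARY B⁗′(b) (DECOUPLING): with the `f`-class of weight exactly `1/p`
  and `p`-integral weights on the other variables of a value-`1` monomial `μ` (supplied by (a) when they weigh `> 1/p`), `p` divides
  the `f`-degree of `μ`, and if `μ` contains an `f`-variable at all it is a pure `f`-monomial of degree `p` — "`P = F(f) + P_V(V)`".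
* NOT here: the sharper unverified variant flagged by the engine ("largest `u` with `v_p(u) ≤ −e` is `≤ p^{−e}`"), the invariant-direction
  half of (b) (see `WeightedCentreInvariantDirection`), THEOREM B⁗ itself.

References: engine 1, THEOREM-LT-eng1-g38 §12 (statement and proof); context [AbramovichTemkinWlodarczyk2024] §5 (weights of a weighted
centre).  Statement and formalisation ours, elementary.
-/

namespace Literature.AlgebraicGeometry.Resolution.WeightedBlowup

namespace PadicPin

open Literature.NumberTheory.Automorphic (not_dvd_den_add not_dvd_den_neg not_dvd_den_sub not_dvd_den_mul not_dvd_den_intCast)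

variable {p : ℕ}

/-- Naturals are `p`-integral (for `p` prime; ours, bookkeeping). [cite: AbramovichTemkinWlodarczyk2024, §5] -/
theorem not_dvd_den_natCast' (hp : p.Prime) (n : ℕ) : ¬ p ∣ ((n : ℚ)).den := by
  simpa using not_dvd_den_intCast hp (n : ℤ)

/-- Finite sums of `p`-integrals are `p`-integral (ours, bookkeeping). [cite: AbramovichTemkinWlodarczyk2024, §5] -/
theorem not_dvd_den_sum (hp : p.Prime) {β : Type*} (s : Finset β) (f : β → ℚ) (h : ∀ b ∈ s, ¬ p ∣ (f b).den) :
    ¬ p ∣ (∑ b ∈ s, f b).den := by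
  classical
  induction s using Finset.induction_on with
  | empty => simpa using not_dvd_den_natCast' hp 0
  | insert a s ha ih =>
      rw [Finset.sum_insert ha]
      exact not_dvd_den_add hp (h a (Finset.mem_insert_self a s)) (ih fun b hb => h b (Finset.mem_insert_of_mem hb))

/-- THE KEY DIVISIBILITY: if `u` is NOT `p`-integral but `n · u` is (`n ∈ ℕ`), then `p ∣ n` (ours; the engine's "`|α|·u₀` is
`p`-integral, which with `v_p(u₀) < 0` forces `p ∣ |α|`"). [cite: AbramovichTemkinWlodarczyk2024, §5] -/
theorem dvd_of_not_dvd_den_mul (hp : p.Prime) {u : ℚ} (hu : p ∣ u.den) {n : ℕ} (hn : ¬ p ∣ ((n : ℚ) * u).den) : p ∣ n := by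
  rcases Nat.eq_zero_or_pos n with rfl | hnpos
  · exact dvd_zero p
  -- `u = (n u) · n⁻¹`, so `den u ∣ den (n u) · n`.
  have hu' : u = ((n : ℚ) * u) * ((n : ℚ))⁻¹ := by
    have hn0 : (n : ℚ) ≠ 0 := by exact_mod_cast hnpos.ne'
    field_simp
  have hdvd : u.den ∣ ((n : ℚ) * u).den * n := by
    have h := Rat.mul_den_dvd ((n : ℚ) * u) ((n : ℚ))⁻¹
    rw [← hu', Rat.inv_natCast_den_of_pos hnpos] at h
    exact h
  rcases (Nat.Prime.dvd_mul hp).mp (hu.trans hdvd) with h1 | h1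
  · exact absurd h1 hn
  · exact h1

/-- **The `p`-adic pin lemma** (COROLLARY B⁗′(a), THEOREM-LT-eng1-g38 §12; ours as a formal statement): if every slot of weight `> 1/p`
has a pin — a value-`1` monomial containing it, in variables at least as heavy — then every slot of weight `> 1/p` has `p`-integral
weight. [cite: AbramovichTemkinWlodarczyk2024, §5] -/
theorem pIntegral_of_pins {N : Type*} [Fintype N] (hp : p.Prime) (w : N → ℚ) (hw : ∀ s, 0 < w s)
    (pin : ∀ ε, 1 / (p : ℚ) < w ε →
      ∃ μ : N →₀ ℕ, 1 ≤ μ ε ∧ (∑ s ∈ μ.support, (μ s : ℚ) * w s) = 1 ∧ ∀ s ∈ μ.support, w ε ≤ w s) :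
    ∀ ε, 1 / (p : ℚ) < w ε → ¬ p ∣ (w ε).den := by
  classical
  by_contra hcon
  push Not at hcon
  -- the bad slots and one of maximal weight
  set B : Finset N := Finset.univ.filter fun ε => 1 / (p : ℚ) < w ε ∧ p ∣ (w ε).den with hB
  have hBne : B.Nonempty := by
    obtain ⟨ε, h1, h2⟩ := hcon
    exact ⟨ε, Finset.mem_filter.mpr ⟨Finset.mem_univ _, h1, h2⟩⟩
  obtain ⟨ε₀, hε₀B, hmax⟩ := Finset.exists_max_image B w hBne
  simp only [hB, Finset.mem_filter, Finset.mem_univ, true_and] at hε₀B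
  obtain ⟨h0, hbad⟩ := hε₀B
  have hmax' : ∀ s, w ε₀ < w s → ¬ p ∣ (w s).den := by
    intro s hs hs'
    have : s ∈ B := Finset.mem_filter.mpr ⟨Finset.mem_univ _, lt_trans h0 hs, hs'⟩
    exact absurd (hmax s this) (not_le.mpr hs)
  obtain ⟨μ, hμε, hval, hheavy⟩ := pin ε₀ h0
  -- split the support into the class of `ε₀` and the heavier slots
  set Sα : Finset N := μ.support.filter fun s => w s = w ε₀ with hSα
  set Sβ : Finset N := μ.support.filter fun s => w ε₀ < w s with hSβ
  have hsplit : (∑ s ∈ μ.support, (μ s : ℚ) * w s) =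
      (∑ s ∈ Sα, (μ s : ℚ) * w s) + ∑ s ∈ Sβ, (μ s : ℚ) * w s := by
    rw [hSα, hSβ, ← Finset.sum_filter_add_sum_filter_not μ.support (fun s => w s = w ε₀)]
    congr 1
    refine Finset.sum_congr ?_ fun _ _ => rfl
    ext s
    simp only [Finset.mem_filter, and_congr_right_iff]
    intro hs
    exact ⟨fun h => lt_of_le_of_ne (hheavy s hs) (Ne.symm h), fun h => h.ne'⟩
  have hα : (∑ s ∈ Sα, (μ s : ℚ) * w s) = ((∑ s ∈ Sα, μ s : ℕ) : ℚ) * w ε₀ := by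
    rw [Nat.cast_sum, Finset.sum_mul]
    refine Finset.sum_congr rfl fun s hs => ?_
    rw [(Finset.mem_filter.mp hs).2]
  -- `|α| · u₀ = 1 − Σ_β` is `p`-integral
  have hβint : ¬ p ∣ (∑ s ∈ Sβ, (μ s : ℚ) * w s).den :=
    not_dvd_den_sum hp _ _ fun s hs => not_dvd_den_mul hp (not_dvd_den_natCast' hp _) (hmax' s (Finset.mem_filter.mp hs).2)
  have hαint : ¬ p ∣ ((((∑ s ∈ Sα, μ s : ℕ) : ℚ) * w ε₀)).den := by
    have : ((∑ s ∈ Sα, μ s : ℕ) : ℚ) * w ε₀ = 1 - ∑ s ∈ Sβ, (μ s : ℚ) * w s := by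
      rw [← hα, ← hval, hsplit]; ring
    rw [this]
    have h1 : ¬ p ∣ (((1 : ℕ) : ℚ)).den := not_dvd_den_natCast' hp 1
    rw [Nat.cast_one] at h1
    exact not_dvd_den_sub hp h1 hβint
  -- hence `p ∣ |α|`, `|α| ≥ p`
  have hpα : p ∣ ∑ s ∈ Sα, μ s := dvd_of_not_dvd_den_mul hp hbad hαint
  have hε₀α : ε₀ ∈ Sα := by
    simp only [hSα, Finset.mem_filter, Finsupp.mem_support_iff, and_true]
    omega
  have hαpos : 0 < ∑ s ∈ Sα, μ s :=
    lt_of_lt_of_le (by omega) (Finset.single_le_sum (fun s _ => Nat.zero_le (μ s)) hε₀α)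
  have hαge : p ≤ ∑ s ∈ Sα, μ s := Nat.le_of_dvd hαpos hpα
  -- `|α| u₀ ≥ p u₀ > 1`
  have hgt : 1 < ((∑ s ∈ Sα, μ s : ℕ) : ℚ) * w ε₀ := by
    have hp0 : (0 : ℚ) < p := by exact_mod_cast hp.pos
    have h1 : 1 < (p : ℚ) * w ε₀ := by
      have := (div_lt_iff₀ hp0).mp h0
      linarith [mul_comm (w ε₀) (p : ℚ)]
    have h2 : (p : ℚ) * w ε₀ ≤ ((∑ s ∈ Sα, μ s : ℕ) : ℚ) * w ε₀ :=
      mul_le_mul_of_nonneg_right (by exact_mod_cast hαge) (hw ε₀).le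
    linarith
  -- but `|α| u₀ = 1 − Σ_β ≤ 1`
  have hβnn : 0 ≤ ∑ s ∈ Sβ, (μ s : ℚ) * w s :=
    Finset.sum_nonneg fun s _ => mul_nonneg (Nat.cast_nonneg _) (hw s).le
  have hle : ((∑ s ∈ Sα, μ s : ℕ) : ℚ) * w ε₀ ≤ 1 := by
    rw [← hα, ← hval, hsplit]
    linarith
  linarith

/-! ## COROLLARY B⁗′(b): DECOUPLING — a value-1 monomial in `f`- and heavier variables containing an `f`-variable is pure of degree `p` -/

/-- **Decoupling, divisibility** (COR B⁗′(b), first clause; ours as a formal statement): if the `f`-class `F` has weight exactly `1/p`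
and every other variable of the value-`1` monomial `μ` has `p`-integral weight, then `p` divides the `f`-degree of `μ`.
[cite: AbramovichTemkinWlodarczyk2024, §5] -/
theorem dvd_fDegree {N : Type*} [DecidableEq N] (hp : p.Prime) (w : N → ℚ) (F : Finset N) (hF : ∀ s ∈ F, w s = 1 / (p : ℚ))
    (μ : N →₀ ℕ) (hint : ∀ s ∈ μ.support, s ∉ F → ¬ p ∣ (w s).den)
    (hval : (∑ s ∈ μ.support, (μ s : ℚ) * w s) = 1) : p ∣ ∑ s ∈ μ.support ∩ F, μ s := by
  classical
  -- split the support into the `f`-part and the rest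
  have hsplit : (∑ s ∈ μ.support, (μ s : ℚ) * w s) =
      (∑ s ∈ μ.support ∩ F, (μ s : ℚ) * w s) + ∑ s ∈ μ.support \ F, (μ s : ℚ) * w s := by
    rw [← Finset.sum_filter_add_sum_filter_not μ.support (fun s => s ∈ F), Finset.filter_mem_eq_inter,
      Finset.sdiff_eq_filter]
  have hα : (∑ s ∈ μ.support ∩ F, (μ s : ℚ) * w s) = ((∑ s ∈ μ.support ∩ F, μ s : ℕ) : ℚ) * (1 / (p : ℚ)) := by
    rw [Nat.cast_sum, Finset.sum_mul]
    refine Finset.sum_congr rfl fun s hs => ?_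
    rw [hF s (Finset.mem_inter.mp hs).2]
  have hβint : ¬ p ∣ (∑ s ∈ μ.support \ F, (μ s : ℚ) * w s).den :=
    not_dvd_den_sum hp _ _ fun s hs =>
      not_dvd_den_mul hp (not_dvd_den_natCast' hp _) (hint s (Finset.mem_sdiff.mp hs).1 (Finset.mem_sdiff.mp hs).2)
  have hαint : ¬ p ∣ ((((∑ s ∈ μ.support ∩ F, μ s : ℕ) : ℚ) * (1 / (p : ℚ)))).den := by
    have : ((∑ s ∈ μ.support ∩ F, μ s : ℕ) : ℚ) * (1 / (p : ℚ)) = 1 - ∑ s ∈ μ.support \ F, (μ s : ℚ) * w s := by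
      rw [← hα, ← hval, hsplit]; ring
    rw [this]
    have h1 : ¬ p ∣ (((1 : ℕ) : ℚ)).den := not_dvd_den_natCast' hp 1
    rw [Nat.cast_one] at h1
    exact not_dvd_den_sub hp h1 hβint
  have hpden : p ∣ (1 / (p : ℚ)).den := by
    rw [one_div, Rat.inv_natCast_den_of_pos hp.pos]
  exact dvd_of_not_dvd_den_mul hp hpden hαint

/-- **Decoupling** (COR B⁗′(b); ours as a formal statement): with positive weights, `f`-class `F` of weight `1/p` and `p`-integral
weights elsewhere on the monomial, a value-`1` monomial that CONTAINS an `f`-variable is a pure `f`-monomial of degree `p` — "heavy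
variables never share a value-1 monomial with `f`-variables": the joint pin part splits as `P = F(f) + P_V(V)`.
[cite: AbramovichTemkinWlodarczyk2024, §5] -/
theorem pure_of_mem_fClass {N : Type*} [DecidableEq N] (hp : p.Prime) (w : N → ℚ) (hw : ∀ s, 0 < w s) (F : Finset N)
    (hF : ∀ s ∈ F, w s = 1 / (p : ℚ)) (μ : N →₀ ℕ) (hint : ∀ s ∈ μ.support, s ∉ F → ¬ p ∣ (w s).den)
    (hval : (∑ s ∈ μ.support, (μ s : ℚ) * w s) = 1) {f : N} (hf : f ∈ μ.support) (hfF : f ∈ F) :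
    μ.support ⊆ F ∧ ∑ s ∈ μ.support, μ s = p := by
  classical
  have hpα : p ∣ ∑ s ∈ μ.support ∩ F, μ s := dvd_fDegree hp w F hF μ hint hval
  have hsplit : (∑ s ∈ μ.support, (μ s : ℚ) * w s) =
      (∑ s ∈ μ.support ∩ F, (μ s : ℚ) * w s) + ∑ s ∈ μ.support \ F, (μ s : ℚ) * w s := by
    rw [← Finset.sum_filter_add_sum_filter_not μ.support (fun s => s ∈ F), Finset.filter_mem_eq_inter,
      Finset.sdiff_eq_filter]
  have hα : (∑ s ∈ μ.support ∩ F, (μ s : ℚ) * w s) = ((∑ s ∈ μ.support ∩ F, μ s : ℕ) : ℚ) * (1 / (p : ℚ)) := by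
    rw [Nat.cast_sum, Finset.sum_mul]
    refine Finset.sum_congr rfl fun s hs => ?_
    rw [hF s (Finset.mem_inter.mp hs).2]
  -- the `f`-degree is positive, hence `≥ p`, hence the `f`-part of the value is `≥ 1`
  have hαpos : 0 < ∑ s ∈ μ.support ∩ F, μ s :=
    lt_of_lt_of_le (Nat.pos_of_ne_zero (Finsupp.mem_support_iff.mp hf))
      (Finset.single_le_sum (fun s _ => Nat.zero_le (μ s)) (Finset.mem_inter.mpr ⟨hf, hfF⟩))
  have hαge : p ≤ ∑ s ∈ μ.support ∩ F, μ s := Nat.le_of_dvd hαpos hpα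
  have hp0 : (0 : ℚ) < p := by exact_mod_cast hp.pos
  have hge1 : 1 ≤ ((∑ s ∈ μ.support ∩ F, μ s : ℕ) : ℚ) * (1 / (p : ℚ)) := by
    rw [mul_one_div, le_div_iff₀ hp0, one_mul]
    exact_mod_cast hαge
  -- the rest of the value is `≥ 0` termwise, so it vanishes termwise
  have hβnn : ∀ s ∈ μ.support \ F, 0 ≤ (μ s : ℚ) * w s := fun s _ => mul_nonneg (Nat.cast_nonneg _) (hw s).le
  have hβ0 : ∑ s ∈ μ.support \ F, (μ s : ℚ) * w s = 0 := by
    have hle : ∑ s ∈ μ.support \ F, (μ s : ℚ) * w s ≤ 0 := by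
      have := hval; rw [hsplit, hα] at this; linarith
    exact le_antisymm hle (Finset.sum_nonneg hβnn)
  have hempty : μ.support \ F = ∅ := by
    by_contra hne
    obtain ⟨s, hs⟩ := Finset.nonempty_iff_ne_empty.mpr hne
    have hspos : 0 < (μ s : ℚ) * w s :=
      mul_pos (by exact_mod_cast Nat.pos_of_ne_zero (Finsupp.mem_support_iff.mp (Finset.mem_sdiff.mp hs).1)) (hw s)
    have := (Finset.sum_eq_zero_iff_of_nonneg hβnn).mp hβ0 s hs
    linarith
  have hsub : μ.support ⊆ F := by
    intro s hs
    by_contra hsF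
    have : s ∈ μ.support \ F := Finset.mem_sdiff.mpr ⟨hs, hsF⟩
    rw [hempty] at this
    exact absurd this (Finset.notMem_empty s)
  refine ⟨hsub, ?_⟩
  have hinter : μ.support ∩ F = μ.support := Finset.inter_eq_left.mpr hsub
  -- `|α|/p = 1`
  have hval' : ((∑ s ∈ μ.support ∩ F, μ s : ℕ) : ℚ) * (1 / (p : ℚ)) = 1 := by
    rw [← hα, ← hval, hsplit, hβ0, add_zero]
  rw [hinter] at hval'
  rw [mul_one_div, div_eq_one_iff_eq hp0.ne'] at hval'
  exact_mod_cast hval'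

/-- **COR B⁗′ (a)+(b) combined** (ours): under the pin hypothesis of `pIntegral_of_pins`, a value-`1` monomial in variables of weight
`≥ 1/p` that contains a variable of weight exactly `1/p` is a pure degree-`p` monomial in the weight-`1/p` class.
[cite: AbramovichTemkinWlodarczyk2024, §5] -/
theorem pure_of_pins {N : Type*} [Fintype N] (hp : p.Prime) (w : N → ℚ) (hw : ∀ s, 0 < w s)
    (pin : ∀ ε, 1 / (p : ℚ) < w ε →
      ∃ μ : N →₀ ℕ, 1 ≤ μ ε ∧ (∑ s ∈ μ.support, (μ s : ℚ) * w s) = 1 ∧ ∀ s ∈ μ.support, w ε ≤ w s)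
    (μ : N →₀ ℕ) (hheavy : ∀ s ∈ μ.support, 1 / (p : ℚ) ≤ w s) (hval : (∑ s ∈ μ.support, (μ s : ℚ) * w s) = 1)
    {f : N} (hf : f ∈ μ.support) (hwf : w f = 1 / (p : ℚ)) :
    (∀ s ∈ μ.support, w s = 1 / (p : ℚ)) ∧ ∑ s ∈ μ.support, μ s = p := by
  classical
  have hint := pIntegral_of_pins hp w hw pin
  set F : Finset N := Finset.univ.filter fun s => w s = 1 / (p : ℚ) with hFdef
  have hF : ∀ s ∈ F, w s = 1 / (p : ℚ) := fun s hs => (Finset.mem_filter.mp hs).2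
  have hint' : ∀ s ∈ μ.support, s ∉ F → ¬ p ∣ (w s).den := by
    intro s hs hsF
    have hne : w s ≠ 1 / (p : ℚ) := fun h => hsF (Finset.mem_filter.mpr ⟨Finset.mem_univ _, h⟩)
    exact hint s (lt_of_le_of_ne (hheavy s hs) (Ne.symm hne))
  have hfF : f ∈ F := Finset.mem_filter.mpr ⟨Finset.mem_univ _, hwf⟩
  obtain ⟨hsub, hdeg⟩ := pure_of_mem_fClass hp w hw F hF μ hint' hval hf hfF
  exact ⟨fun s hs => hF s (hsub hs), hdeg⟩

end PadicPin

end Literature.AlgebraicGeometry.Resolution.WeightedBlowup
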